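import Summits.ResolutionOfSingularities.ResolutionOfSingularities.Theorems.WeightedInvariantQuasiRegularWeightedMonomialsPrimary
import Literature.AlgebraicGeometry.Resolution.RegularQuotientIdeal
import Mathlib.RingTheory.Localization.Ideal
import HarnessLib

/-!
# Weighted-chart pieces in a regular local ring are primary, and primary ideals are read at their radical

Route `ResolutionOfSingularities/WeightedInvariant`, door crux `HypersurfaceCentreConstruction`
(stmt-ResolutionOfSingularities-19897) — OURS, helper; e-ladder plan of `res-L1-w43-stub-10`, lemma L3 /
T-e1-L0 (cell res-hironaka, `D/res-D-pv-025/DOOR-ELADDER-PLAN.md` §6): «a weighted-chart piece is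
`(u)`-primary, hence determined by its germ at the generic point of `V(u)`».  This file packages the two
ring-level facts the scheme-level comparison of two candidate centres (e.g. `act*J` and `pr*J` on a torus
chart) consumes:

* `isPrimary_span_weightedMonomials_of_linearIndependent_toCotangent` — in a REGULAR LOCAL ring, for
  elements `x₁, …, x_c ∈ 𝔪` with linearly independent images in `𝔪/𝔪²` (= part of a regular system of
  parameters: the stalk form of `ReesAlgebraData.IsWeightedChart.linearIndependent`) and positive weights,
  every piece `𝒥ₙ = (x^α : Σ αᵢwᵢ ≥ n)`, `n ≥ 1`, is PRIMARY with radical the prime `(x)` — the tree's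
  `isQuasiRegular_of_linearIndependent_toCotangent` / `isPrime_span_image_of_linearIndependent_toCotangent`
  (Matsumura 14.2, 16.2) fed into `isPrimary_span_weightedMonomials`;
* `eq_of_isPrimary_of_map_eq` — two primary ideals with radicals inside a prime `𝔭` that agree after
  localisation at `𝔭` are equal (Mathlib `IsLocalization.under_map_of_isPrimary_disjoint`);
* `span_weightedMonomials_eq_of_map_eq` — hence two weighted-chart filtrations on (possibly different)
  regular parameter systems `x`, `y` of the same regular local ring with `(x) = (y) =: 𝔮` prime, which agree
  piecewise after localisation at `𝔮` (i.e. at the generic point of the centre), agree.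

Pure commutative algebra; no named facts.
-/

noncomputable section

set_option linter.dupNamespace false -- mandated namespace of this single-conjunct summit

namespace Summit.ResolutionOfSingularities.ResolutionOfSingularities.Theorems

universe u

open IsLocalRing Literature.AlgebraicGeometry.Resolution

/-! ## Weighted-chart pieces at a point of the centre are primary -/

/-- **In a regular local ring, the weighted pieces on part of a regular system of parameters are primary.**
For `x : Fin c → R`, `xᵢ ∈ 𝔪` with linearly independent images in `𝔪/𝔪²`, positive weights `w` and `n ≥ 1`:
`𝒥ₙ = Ideal.span (weightedMonomials x w n)` is a primary ideal and its radical is the prime `(x)`.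
[cite: Matsumura1987, Thm. 14.2 and Thm. 16.2] -/
theorem isPrimary_span_weightedMonomials_of_linearIndependent_toCotangent {R : Type u} [CommRing R]
    [IsRegularLocalRing R] {c : ℕ} (x : Fin c → R) (hx : ∀ i, x i ∈ maximalIdeal R)
    (hli : LinearIndependent (ResidueField R) fun i => (maximalIdeal R).toCotangent ⟨x i, hx i⟩)
    (w : Fin c → ℕ) (hw : ∀ i, 0 < w i) {n : ℕ} (hn : 1 ≤ n) :
    (Ideal.span (weightedMonomials x w n)).IsPrimary ∧
      (Ideal.span (weightedMonomials x w n)).radical = Ideal.span (Set.range x) := by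
  have hq : IsQuasiRegular x := isQuasiRegular_of_linearIndependent_toCotangent x hx hli
  have hprime : (Ideal.span (Set.range x)).IsPrime := by
    have h := isPrime_span_image_of_linearIndependent_toCotangent x hx hli Set.univ
    rwa [Set.image_univ] at h
  exact ⟨isPrimary_span_weightedMonomials x w hq hw hn hprime,
    radical_span_weightedMonomials x w hw hn hprime.isRadical⟩

/-- At such a point, the colon property: `a ∉ (x)` and `a · b ∈ 𝒥ₙ` force `b ∈ 𝒥ₙ`. [folklore] -/
theorem mem_span_weightedMonomials_of_mul_mem_of_linearIndependent_toCotangent {R : Type u} [CommRing R]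
    [IsRegularLocalRing R] {c : ℕ} (x : Fin c → R) (hx : ∀ i, x i ∈ maximalIdeal R)
    (hli : LinearIndependent (ResidueField R) fun i => (maximalIdeal R).toCotangent ⟨x i, hx i⟩)
    (w : Fin c → ℕ) (hw : ∀ i, 0 < w i) (n : ℕ) {a b : R} (ha : a ∉ Ideal.span (Set.range x))
    (hab : a * b ∈ Ideal.span (weightedMonomials x w n)) : b ∈ Ideal.span (weightedMonomials x w n) := by
  have hq : IsQuasiRegular x := isQuasiRegular_of_linearIndependent_toCotangent x hx hli
  have hprime : (Ideal.span (Set.range x)).IsPrime := by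
    have h := isPrime_span_image_of_linearIndependent_toCotangent x hx hli Set.univ
    rwa [Set.image_univ] at h
  exact mem_span_weightedMonomials_of_mul_mem x w hq hw
    (fun y hy => (hprime.mem_or_mem hy).resolve_left ha) n hab

/-! ## Primary ideals are determined by their localisation at the radical -/

/-- **Two primary ideals whose radicals lie in a prime `𝔭` and which agree in the localisation at `𝔭` are
equal** (each is the contraction of its extension, Mathlib `IsLocalization.under_map_of_isPrimary_disjoint`).
[folklore] -/
theorem eq_of_isPrimary_of_map_eq {R : Type u} [CommRing R] (𝔭 : Ideal R) [𝔭.IsPrime]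
    (S : Type u) [CommRing S] [Algebra R S] [IsLocalization.AtPrime S 𝔭] {Q₁ Q₂ : Ideal R}
    (h₁ : Q₁.IsPrimary) (h₂ : Q₂.IsPrimary) (hr₁ : Q₁.radical ≤ 𝔭) (hr₂ : Q₂.radical ≤ 𝔭)
    (h : Q₁.map (algebraMap R S) = Q₂.map (algebraMap R S)) : Q₁ = Q₂ := by
  have hd : ∀ {Q : Ideal R}, Q.radical ≤ 𝔭 → Disjoint (𝔭.primeCompl : Set R) Q := fun hr =>
    Set.disjoint_left.mpr fun s hs hsQ => hs (hr (Ideal.le_radical hsQ))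
  rw [← IsLocalization.under_map_of_isPrimary_disjoint 𝔭.primeCompl S h₁ (hd hr₁),
    ← IsLocalization.under_map_of_isPrimary_disjoint 𝔭.primeCompl S h₂ (hd hr₂), h]

/-- **Weighted-chart filtrations are read at the generic point of the centre.**  In a regular local ring, let
`x, y : Fin c → 𝔪` both have linearly independent differentials and generate the SAME (prime) ideal
`𝔮 = (x) = (y)`, and let `w` be positive weights.  If for some `n ≥ 1` the pieces `(x^α : w·α ≥ n)` and
`(y^α : w·α ≥ n)` agree after localisation at `𝔮`, they agree.  (Both are `𝔮`-primary by
`isPrimary_span_weightedMonomials_of_linearIndependent_toCotangent`; the instance `(x).IsPrime` is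
`isPrime_span_image_of_linearIndependent_toCotangent x hx hlix Set.univ` up to `Set.image_univ`.) [folklore] -/
theorem span_weightedMonomials_eq_of_map_eq {R : Type u} [CommRing R] [IsRegularLocalRing R] {c : ℕ}
    (x y : Fin c → R) (hx : ∀ i, x i ∈ maximalIdeal R) (hy : ∀ i, y i ∈ maximalIdeal R)
    (hlix : LinearIndependent (ResidueField R) fun i => (maximalIdeal R).toCotangent ⟨x i, hx i⟩)
    (hliy : LinearIndependent (ResidueField R) fun i => (maximalIdeal R).toCotangent ⟨y i, hy i⟩)
    (hxy : Ideal.span (Set.range x) = Ideal.span (Set.range y))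
    (w : Fin c → ℕ) (hw : ∀ i, 0 < w i) {n : ℕ} (hn : 1 ≤ n)
    [(Ideal.span (Set.range x)).IsPrime] (S : Type u) [CommRing S] [Algebra R S]
    [IsLocalization.AtPrime S (Ideal.span (Set.range x))]
    (h : (Ideal.span (weightedMonomials x w n)).map (algebraMap R S) =
      (Ideal.span (weightedMonomials y w n)).map (algebraMap R S)) :
    Ideal.span (weightedMonomials x w n) = Ideal.span (weightedMonomials y w n) := by
  obtain ⟨h₁, hr₁⟩ := isPrimary_span_weightedMonomials_of_linearIndependent_toCotangent x hx hlix w hw hn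
  obtain ⟨h₂, hr₂⟩ := isPrimary_span_weightedMonomials_of_linearIndependent_toCotangent y hy hliy w hw hn
  exact eq_of_isPrimary_of_map_eq (Ideal.span (Set.range x)) S h₁ h₂ hr₁.le (hr₂.trans_le hxy.symm.le) h

end Summit.ResolutionOfSingularities.ResolutionOfSingularities.Theorems

end
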